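import Literature.AlgebraicGeometry.Resolution.WeightedCentreLowestClassKill
import HarnessLib

/-!
# Weighted centres — THEOREM A⁺, last step: kill coordinates for a `k[T]`-substitution moving the bottom class

Instrument for engine 1's `W(f)` TOY MODEL (cell `pub-rosobs`, LF-MODEL-eng1-g45 §6.2 THEOREM A⁺, last sentence of both cases: "L7 at `Y := L₁` with `T := τ` ⇒ (P) fails at
`L₁` ✗"), NOT a resolution theorem and NOT about the invariant of [AbramovichTemkinWlodarczyk2024].

The generalised L7 (`WeightedCentreKillCoordinates`, g64) needs, for a `k`-algebra substitution `ψ : k[ε] → k[ε][T]`, a rank making `Π″ − id` triangular.  For the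
`k[T]`-substitution produced by THEOREM A⁺ (`WeightedCentreBottomExpand`: `x ∘ C = expand_r ∘ ψ`) the hypotheses are pure WEIGHT bookkeeping: `ψ(ε_i) ≡ ε_i (mod T)`, the higher
`T`-coefficients of `ψ(ε_i)` involve only variables LIGHTER than `ε_i`, and the pinned slot `z` has MINIMAL weight.  Then `rk := TailedLightFlow.killRank w z` works
(`killRank_lt_of_bottom`), the kill coordinates `bottomKill` exist, and `(P)` fails at the class of `z` for `Λ⁻¹ g` whenever `ψ(ε_z) = ε_z + cT`, `c ≠ 0`, `ψ(g) = g`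
(`not_classPinned_bottomKill` = `KillCoordinates.not_classPinned_symm_apply`).

References: [Lang2002, Ch. IV §1, Ch. XIII §4]; [Matsumura1987, §27]; [AbramovichTemkinWlodarczyk2024, §5.1 (p. 1575), Thm. 5.3.1 (2)–(3) (p. 1578)].
-/

namespace Literature.AlgebraicGeometry.Resolution.WeightedBlowup.BottomClimb

open Polynomial

section Kill

variable {k : Type*} [Field k] {ι : Type*} [Fintype ι] [DecidableEq ι] {w : ι → ℚ}

/-- **The triangularity hypothesis `hrk` of `KillCoordinates.killEquiv` from weights** (bottom version of `TailedLightFlow.IsTailedLightFlow.killRank_lt`): `ψ(ε_i) ≡ ε_i (mod T)`,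
higher `T`-coefficients in lighter variables, `z` of minimal weight ⇒ `Π″(ε_i) − ε_i` has `killRank w z`-rank `< rk i` (bookkeeping). [cite: Lang2002, Ch. IV §1] -/
theorem killRank_lt_of_bottom (ψ : MvPolynomial ι k →ₐ[k] (MvPolynomial ι k)[X]) (z : ι) (c : k) (hmin : ∀ j, w z ≤ w j)
    (h0 : ∀ i, (ψ (MvPolynomial.X i)).coeff 0 = MvPolynomial.X i)
    (htri : ∀ i, ∀ n, 1 ≤ n → ∀ j ∈ ((ψ (MvPolynomial.X i)).coeff n).vars, w j < w i) :
    ∀ i, ∀ j ∈ (KillCoordinates.killSubst ψ z c i - MvPolynomial.X i).vars, TailedLightFlow.killRank w z j < TailedLightFlow.killRank w z i :=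
  KillCoordinates.rk_lt_of_mem_vars_killSubst_sub ψ z c (TailedLightFlow.killRank w z) h0
    (fun i n hn j hj => TailedLightFlow.killRank_lt_of_lt w z (htri i n hn j hj))
    fun i hiz _ => (lt_or_eq_of_le (hmin i)).elim (TailedLightFlow.killRank_lt_of_lt w z)
      fun h => TailedLightFlow.killRank_lt_of_eq w z h.symm hiz

/-- **The kill coordinates `Λ` of THEOREM A⁺** (construction: `KillCoordinates.killEquiv ψ z c (killRank w z)`). [cite: Lang2002, Ch. IV §1] -/
noncomputable def bottomKill (ψ : MvPolynomial ι k →ₐ[k] (MvPolynomial ι k)[X]) (z : ι) (c : k) (hmin : ∀ j, w z ≤ w j)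
    (h0 : ∀ i, (ψ (MvPolynomial.X i)).coeff 0 = MvPolynomial.X i)
    (htri : ∀ i, ∀ n, 1 ≤ n → ∀ j ∈ ((ψ (MvPolynomial.X i)).coeff n).vars, w j < w i) : MvPolynomial ι k ≃ₐ[k] MvPolynomial ι k :=
  KillCoordinates.killEquiv ψ z c (TailedLightFlow.killRank w z) (killRank_lt_of_bottom ψ z c hmin h0 htri)

/-- `Λ ε_i = Π″(ε_i)` (bookkeeping). [cite: Lang2002, Ch. IV §1] -/
theorem bottomKill_X (ψ : MvPolynomial ι k →ₐ[k] (MvPolynomial ι k)[X]) (z : ι) (c : k) (hmin : ∀ j, w z ≤ w j)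
    (h0 : ∀ i, (ψ (MvPolynomial.X i)).coeff 0 = MvPolynomial.X i)
    (htri : ∀ i, ∀ n, 1 ≤ n → ∀ j ∈ ((ψ (MvPolynomial.X i)).coeff n).vars, w j < w i) (i : ι) :
    bottomKill ψ z c hmin h0 htri (MvPolynomial.X i) = KillCoordinates.killSubst ψ z c i :=
  KillCoordinates.killEquiv_X ψ z c _ _ i

/-- `Λ` is GRADED (bookkeeping over `KillCoordinates.isWeightedHomogeneous_killEquiv`… stated via `killEquiv_apply`): `Λ⁻¹ g = g|_{ε_z = 0}` when `ψ(ε_z) = ε_z + cT`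
(`KillCoordinates.symm_apply_eq_kill`). [cite: Lang2002, Ch. IV §1] -/
theorem bottomKill_symm_apply (ψ : MvPolynomial ι k →ₐ[k] (MvPolynomial ι k)[X]) (z : ι) {c : k} (hmin : ∀ j, w z ≤ w j)
    (h0 : ∀ i, (ψ (MvPolynomial.X i)).coeff 0 = MvPolynomial.X i)
    (htri : ∀ i, ∀ n, 1 ≤ n → ∀ j ∈ ((ψ (MvPolynomial.X i)).coeff n).vars, w j < w i) (hc : c ≠ 0)
    (hz : ψ (MvPolynomial.X z) = C (MvPolynomial.X z) + C (MvPolynomial.C c) * X) {g : MvPolynomial ι k} (hg : ψ g = C g) :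
    (bottomKill ψ z c hmin h0 htri).symm g = ParameterKill.kill z g :=
  KillCoordinates.symm_apply_eq_kill ψ z c _ _ hc hz hg

/-- **THEOREM A⁺, LAST STEP: `(P)` FAILS AT THE BOTTOM CLASS IN THE KILL COORDINATES** — if the `k[T]`-substitution `ψ` (`T` free; from `exists_expand_slots` / `sigmaExp_eq_C_of_three_le`)
fixes `g`, moves the minimal-weight slot `z` by `ψ(ε_z) = ε_z + cT` with `c ≠ 0` (`sigmaExp_X_of_apply_eq_C`), and is bottom-triangular, then `Λ⁻¹ g` is not class-pinned at `z` for
any class `S ∋ z` (L7 = `KillCoordinates.not_classPinned_symm_apply`).  Instrument for engine 1's `W(f)` toy model, NOT a resolution theorem.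
[cite: Lang2002, Ch. IV §1, Ch. XIII §4; Matsumura1987, §27 (p. 207); AbramovichTemkinWlodarczyk2024, Thm. 5.3.1 (2)–(3) (p. 1578)] -/
theorem not_classPinned_bottomKill (ψ : MvPolynomial ι k →ₐ[k] (MvPolynomial ι k)[X]) (z : ι) {c : k} (hmin : ∀ j, w z ≤ w j)
    (h0 : ∀ i, (ψ (MvPolynomial.X i)).coeff 0 = MvPolynomial.X i)
    (htri : ∀ i, ∀ n, 1 ≤ n → ∀ j ∈ ((ψ (MvPolynomial.X i)).coeff n).vars, w j < w i) (hc : c ≠ 0)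
    (hz : ψ (MvPolynomial.X z) = C (MvPolynomial.X z) + C (MvPolynomial.C c) * X) {g : MvPolynomial ι k} (hg : ψ g = C g)
    {S : Finset ι} (hzS : z ∈ S) :
    ¬ InvariantDirection.ClassPinned S ((bottomKill ψ z c hmin h0 htri).symm g) z :=
  KillCoordinates.not_classPinned_symm_apply ψ z c _ _ hc hz hg hzS

end Kill

end Literature.AlgebraicGeometry.Resolution.WeightedBlowup.BottomClimb
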